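import Literature.Computability.Complexity.HardcoreInapproximabilitySecondMomentOuter
import HarnessLib

/-!
# Boundary shifts in the second-moment analysis

The colour form `M_B` as a planar quadratic form (`slyM11`, `slyM12`, `slyM22`, `slyMB_eq_form`),
its size from `-H_d ≻ κ` (`abs_slyMB_le`) and its increments (`abs_slyMB_sub_le`); and the entropy
shift lemma for integer arguments, `|x' log x' - x log x| ≤ |x' - x| (1 + log M)`
(`abs_mul_log_sub_mul_log_le`, `abs_entB_nat_sub_le`), which controls the effect of the `m'`
boundary vertices of Sly's core on the rates of the big matchings.

## References
* [Sly2010] A. Sly, FOCS 2010 / arXiv:1005.5584, Lemma 3.5 (boundary corrections `e^{O(m')}`).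
* [MosselWeitzWormald2008] E. Mossel, D. Weitz, N. Wormald, PTRF 143 (2009), §5.
-/

namespace Literature.Computability.Complexity

open Real Finset Literature.Analysis.SpecialFunctions

section MForm

variable (α β : ℝ)

/-- Entry `M₁₁ = b₁₃²/κ₃ + b₁₁` of the colour form `M_B(h₁,h₂) = ½ hᵀ M h`. [folklore] -/
noncomputable def slyM11 : ℝ := slyB13 α β ^ 2 / slyK3 α β + slyB11 α β

/-- Entry `M₁₂ = b₁₃b₂₃/κ₃ + b₂₃`. [folklore] -/
noncomputable def slyM12 : ℝ := slyB13 α β * slyB23 α β / slyK3 α β + slyB23 α β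

/-- Entry `M₂₂ = b₂₃²/κ₃ + b₂₂`. [folklore] -/
noncomputable def slyM22 : ℝ := slyB23 α β ^ 2 / slyK3 α β + slyB22 α β

variable {α β}

/-- **`M_B` in coordinates.** [folklore] -/
theorem slyMB_eq_form (h₁ h₂ : ℝ) :
    slyMB α β h₁ h₂ = (slyM11 α β * h₁ ^ 2 + 2 * slyM12 α β * h₁ * h₂ + slyM22 α β * h₂ ^ 2) / 2 := by
  unfold slyMB slyM11 slyM12 slyM22
  ring

/-- **Size of `M_B`**: `|M_B(h₁,h₂)| ≤ K' (|h₁|+|h₂|)²` with `K' = 3(d+2)/m⁵ + 6/m⁵` for any `d ≥ 1`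
with `-H_d ≻ 0` (here from `-H_d ≻ κ`). [folklore] -/
theorem abs_slyMB_le {d : ℕ} (hd : 1 ≤ d) (hα : 0 < α) (hβ : 0 < β) (hαβ : α + β < 1) {m : ℝ}
    (hm : m = min (min α β) (1 - α - β)) {κ : ℝ} (hκ : 0 < κ)
    (hPD : ∀ h₁ h₂ h₃ : ℝ, slyQ d α β h₁ h₂ h₃ ≤ -κ * (h₁ ^ 2 + h₂ ^ 2 + h₃ ^ 2)) (h₁ h₂ : ℝ) :
    |slyMB α β h₁ h₂| ≤ (3 * ((d : ℝ) + 2) / m ^ 5 + 6 / m ^ 5) * (|h₁| + |h₂|) ^ 2 := by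
  have hdR : (1 : ℝ) ≤ d := by exact_mod_cast hd
  have hd0 : (0 : ℝ) < d := by linarith
  -- `d M_B = S - Q₀` with `-K s² ≤ S ≤ 0` and `|Q₀| ≤ 6 s²/m⁵`
  have hS1 : slyQ 0 α β h₁ h₂ 0 + d * slyMB α β h₁ h₂ ≤ 0 := by
    rw [slyS_eq_slyQ_hhat hα hβ hαβ]
    have := hPD h₁ h₂ (slyHhat α β h₁ h₂)
    nlinarith [sq_nonneg h₁, sq_nonneg h₂, sq_nonneg (slyHhat α β h₁ h₂)]
  have hS2 := slyQ_plane_le_slyS (d := d) hα hβ hαβ h₁ h₂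
  have hQd := abs_slyQ_plane_le d hα hβ hαβ hm h₁ h₂
  have hQ0 := abs_slyQ_plane_le 0 hα hβ hαβ hm h₁ h₂
  push_cast at hQ0
  norm_num at hQ0
  rw [abs_le] at hQd hQ0 ⊢
  have hm0 : 0 < m := by rw [hm]; exact lt_min (lt_min hα hβ) (by linarith)
  have hs : 0 ≤ (|h₁| + |h₂|) ^ 2 := by positivity
  have hm5 : 0 < 1 / m ^ 5 := by positivity
  have e1 : 3 * ((d : ℝ) + 2) / m ^ 5 = 3 * ((d : ℝ) + 2) * (1 / m ^ 5) := by ring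
  have e2 : (6 : ℝ) / m ^ 5 = 6 * (1 / m ^ 5) := by ring
  rw [e1, e2]
  rw [e1] at hQd
  rw [e2] at hQ0
  set u := 1 / m ^ 5 with hu
  set s2 := (|h₁| + |h₂|) ^ 2 with hs2
  -- `d MB ≤ -Q₀ ≤ 6 u s2`, `d MB ≥ Q_d - Q₀ ≥ -(3(d+2) u + 6u) s2`
  constructor
  · have h1 : -( (3 * ((d : ℝ) + 2) * u + 6 * u) * s2) ≤ (d : ℝ) * slyMB α β h₁ h₂ := by
      nlinarith [hQd.1, hQ0.2, hS2]
    have h2 : -((3 * ((d : ℝ) + 2) * u + 6 * u) * s2) * 1 ≥ -((3 * ((d : ℝ) + 2) * u + 6 * u) * s2) * d := by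
      have : 0 ≤ (3 * ((d : ℝ) + 2) * u + 6 * u) * s2 := by positivity
      nlinarith
    nlinarith
  · have h1 : (d : ℝ) * slyMB α β h₁ h₂ ≤ 6 * u * s2 := by nlinarith [hQ0.1, hS1]
    have h3 : 6 * u * s2 ≤ (3 * ((d : ℝ) + 2) * u + 6 * u) * s2 * d := by
      have : 0 ≤ u * s2 := by positivity
      nlinarith
    nlinarith

/-- **Increments of `M_B`**: `|M_B(h) - M_B(h')| ≤ 4K'(|h₁|+|h₂|+|h₁'|+|h₂'|)(|h₁-h₁'|+|h₂-h₂'|)`.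
[folklore] -/
theorem abs_slyMB_sub_le {d : ℕ} (hd : 1 ≤ d) (hα : 0 < α) (hβ : 0 < β) (hαβ : α + β < 1) {m : ℝ}
    (hm : m = min (min α β) (1 - α - β)) {κ : ℝ} (hκ : 0 < κ)
    (hPD : ∀ h₁ h₂ h₃ : ℝ, slyQ d α β h₁ h₂ h₃ ≤ -κ * (h₁ ^ 2 + h₂ ^ 2 + h₃ ^ 2))
    (h₁ h₂ h₁' h₂' : ℝ) :
    |slyMB α β h₁ h₂ - slyMB α β h₁' h₂'| ≤
      4 * (3 * ((d : ℝ) + 2) / m ^ 5 + 6 / m ^ 5) * (|h₁| + |h₂| + |h₁'| + |h₂'|) *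
        (|h₁ - h₁'| + |h₂ - h₂'|) := by
  set K := 3 * ((d : ℝ) + 2) / m ^ 5 + 6 / m ^ 5 with hK
  have hm0 : 0 < m := by rw [hm]; exact lt_min (lt_min hα hβ) (by linarith)
  have hK0 : 0 ≤ K := by positivity
  -- bounds on the entries from `|M_B| ≤ K s²`
  have B := abs_slyMB_le hd hα hβ hαβ hm hκ hPD
  have b11 := B 1 0
  have b22 := B 0 1
  have bP := B 1 1
  have bM := B 1 (-1)
  rw [slyMB_eq_form] at b11 b22 bP bM
  simp only [abs_one, abs_zero, abs_neg, one_pow, zero_pow two_ne_zero, mul_one, mul_zero,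
    add_zero, zero_add, mul_neg] at b11 b22 bP bM
  norm_num at b11 b22 bP bM
  rw [← hK] at b11 b22 bP bM
  rw [abs_le] at b11 b22 bP bM
  have hM11 : |slyM11 α β| ≤ 2 * K := by rw [abs_le]; constructor <;> linarith [b11.1, b11.2]
  have hM22 : |slyM22 α β| ≤ 2 * K := by rw [abs_le]; constructor <;> linarith [b22.1, b22.2]
  have hM12 : |slyM12 α β| ≤ 4 * K := by
    rw [abs_le]; constructor <;> linarith [bP.1, bP.2, bM.1, bM.2]
  -- the increment identity
  have e : slyMB α β h₁ h₂ - slyMB α β h₁' h₂' =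
      (slyM11 α β * (h₁ + h₁') * (h₁ - h₁') + 2 * slyM12 α β * (h₁ * (h₂ - h₂') + h₂' * (h₁ - h₁')) +
        slyM22 α β * (h₂ + h₂') * (h₂ - h₂')) / 2 := by
    rw [slyMB_eq_form, slyMB_eq_form]; ring
  rw [e]
  have a1 := abs_nonneg h₁; have a2 := abs_nonneg h₂; have a3 := abs_nonneg h₁'
  have a4 := abs_nonneg h₂'
  have d1 := abs_nonneg (h₁ - h₁'); have d2 := abs_nonneg (h₂ - h₂')
  have t1 : |slyM11 α β * (h₁ + h₁') * (h₁ - h₁')| ≤ 2 * K * (|h₁| + |h₁'|) * |h₁ - h₁'| := by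
    rw [abs_mul, abs_mul]
    apply mul_le_mul (mul_le_mul hM11 (abs_add_le _ _) (abs_nonneg _) (by positivity)) le_rfl d1
      (by positivity)
  have t2 : |2 * slyM12 α β * (h₁ * (h₂ - h₂') + h₂' * (h₁ - h₁'))| ≤
      2 * (4 * K) * (|h₁| * |h₂ - h₂'| + |h₂'| * |h₁ - h₁'|) := by
    rw [abs_mul, abs_mul, abs_two]
    apply mul_le_mul (mul_le_mul_of_nonneg_left hM12 (by norm_num)) _ (abs_nonneg _) (by positivity)
    calc |h₁ * (h₂ - h₂') + h₂' * (h₁ - h₁')| ≤ |h₁ * (h₂ - h₂')| + |h₂' * (h₁ - h₁')| := abs_add_le _ _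
      _ = |h₁| * |h₂ - h₂'| + |h₂'| * |h₁ - h₁'| := by rw [abs_mul, abs_mul]
  have t3 : |slyM22 α β * (h₂ + h₂') * (h₂ - h₂')| ≤ 2 * K * (|h₂| + |h₂'|) * |h₂ - h₂'| := by
    rw [abs_mul, abs_mul]
    apply mul_le_mul (mul_le_mul hM22 (abs_add_le _ _) (abs_nonneg _) (by positivity)) le_rfl d2
      (by positivity)
  rw [abs_div, abs_two]
  rw [div_le_iff₀ (by norm_num : (0:ℝ) < 2)]
  calc |slyM11 α β * (h₁ + h₁') * (h₁ - h₁') + 2 * slyM12 α β * (h₁ * (h₂ - h₂') + h₂' * (h₁ - h₁')) +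
        slyM22 α β * (h₂ + h₂') * (h₂ - h₂')|
      ≤ 2 * K * (|h₁| + |h₁'|) * |h₁ - h₁'| + 2 * (4 * K) * (|h₁| * |h₂ - h₂'| + |h₂'| * |h₁ - h₁'|) +
          2 * K * (|h₂| + |h₂'|) * |h₂ - h₂'| :=
        le_trans (abs_add_le _ _) (add_le_add (le_trans (abs_add_le _ _) (add_le_add t1 t2)) t3)
    _ ≤ 4 * K * (|h₁| + |h₂| + |h₁'| + |h₂'|) * (|h₁ - h₁'| + |h₂ - h₂'|) * 2 := by
        nlinarith [mul_nonneg hK0 (mul_nonneg a1 d1), mul_nonneg hK0 (mul_nonneg a1 d2),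
          mul_nonneg hK0 (mul_nonneg a2 d1), mul_nonneg hK0 (mul_nonneg a2 d2),
          mul_nonneg hK0 (mul_nonneg a3 d1), mul_nonneg hK0 (mul_nonneg a3 d2),
          mul_nonneg hK0 (mul_nonneg a4 d1), mul_nonneg hK0 (mul_nonneg a4 d2)]

end MForm

section EntShift

/-- `u ↦ u log u` has increments at most `1 + log M` per unit on the naturals `≤ M`:
`(x+1) log (x+1) - x log x ≤ 1 + log M` for `x + 1 ≤ M`, and `≥ 0`. [folklore] -/
theorem mul_log_succ_sub {x M : ℕ} (hxM : x + 1 ≤ M) :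
    0 ≤ ((x : ℝ) + 1) * Real.log ((x : ℝ) + 1) - x * Real.log x ∧
      ((x : ℝ) + 1) * Real.log ((x : ℝ) + 1) - x * Real.log x ≤ 1 + Real.log M := by
  have hM : (1 : ℝ) ≤ M := by exact_mod_cast (le_trans (Nat.le_add_left 1 x) hxM)
  have hx1 : ((x : ℝ) + 1) ≤ M := by exact_mod_cast hxM
  rcases Nat.eq_zero_or_pos x with rfl | hx
  · push_cast
    simp only [zero_add, Real.log_one, mul_zero, zero_mul, sub_zero]
    exact ⟨le_refl 0, by linarith [Real.log_nonneg hM]⟩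
  have hxR : (0 : ℝ) < x := by exact_mod_cast hx
  have hlx : Real.log x ≤ Real.log ((x : ℝ) + 1) := Real.log_le_log hxR (by linarith)
  have hlM : Real.log ((x : ℝ) + 1) ≤ Real.log M := Real.log_le_log (by linarith) hx1
  -- `x (log (x+1) - log x) = x log (1 + 1/x) ≤ 1`
  have hinc : (x : ℝ) * (Real.log ((x : ℝ) + 1) - Real.log x) ≤ 1 := by
    rw [← Real.log_div (by linarith) hxR.ne']
    have := Real.log_le_sub_one_of_pos (show (0:ℝ) < ((x : ℝ) + 1) / x by positivity)
    rw [show ((x : ℝ) + 1) / x - 1 = 1 / x by field_simp; ring] at this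
    calc (x : ℝ) * Real.log (((x : ℝ) + 1) / x) ≤ x * (1 / x) := mul_le_mul_of_nonneg_left this hxR.le
      _ = 1 := by field_simp
  constructor
  · nlinarith [Real.log_nonneg (show (1:ℝ) ≤ (x : ℝ) + 1 by linarith)]
  · nlinarith

/-- **The entropy shift lemma**: `|x' log x' - x log x| ≤ |x' - x| (1 + log M)` for naturals
`x, x' ≤ M`. [folklore] -/
theorem abs_mul_log_sub_mul_log_le {x x' M : ℕ} (hx : x ≤ M) (hx' : x' ≤ M) :
    |(x' : ℝ) * Real.log x' - x * Real.log x| ≤ |(x' : ℝ) - x| * (1 + Real.log M) := by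
  -- by induction on the difference, for `x ≤ x'`
  have key : ∀ (y t : ℕ), y + t ≤ M →
      0 ≤ ((y + t : ℕ) : ℝ) * Real.log ((y + t : ℕ) : ℝ) - y * Real.log y ∧
      ((y + t : ℕ) : ℝ) * Real.log ((y + t : ℕ) : ℝ) - y * Real.log y ≤ t * (1 + Real.log M) := by
    intro y t
    induction t with
    | zero => intro _; simp
    | succ t ih =>
      intro hyt
      have ih' := ih (by omega)
      have st := mul_log_succ_sub (x := y + t) (M := M) (by omega)
      push_cast at st ih' ⊢
      rw [show ((y : ℝ) + ((t : ℝ) + 1)) = ((y : ℝ) + (t : ℝ)) + 1 by ring]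
      constructor <;> linarith [ih'.1, ih'.2, st.1, st.2]
  rcases le_total x x' with hle | hle
  · obtain ⟨t, rfl⟩ := Nat.exists_eq_add_of_le hle
    have := key x t hx'
    rw [abs_of_nonneg this.1, show ((x + t : ℕ) : ℝ) - x = t by push_cast; ring, Nat.abs_cast]
    exact this.2
  · obtain ⟨t, rfl⟩ := Nat.exists_eq_add_of_le hle
    have := key x' t hx
    rw [abs_sub_comm, abs_of_nonneg this.1, show ((x' : ℕ) : ℝ) - ((x' + t : ℕ) : ℝ) = -t by
      push_cast; ring, abs_neg, Nat.abs_cast]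
    exact this.2

/-- **Shifted entropy forms**: `|entB m' k' - entB m k| ≤ (|m'-m| + |k'-k| + |(m'-k')-(m-k)|)(1 + log M)`
for naturals at most `M` with `k ≤ m`, `k' ≤ m'`. [folklore] -/
theorem abs_entB_nat_sub_le {m k m' k' M : ℕ} (hkm : k ≤ m) (hkm' : k' ≤ m') (hm : m ≤ M)
    (hm' : m' ≤ M) :
    |entB (m' : ℝ) k' - entB (m : ℝ) k| ≤
      (|(m' : ℝ) - m| + |(k' : ℝ) - k| + |((m' - k' : ℕ) : ℝ) - ((m - k : ℕ) : ℝ)|) *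
        (1 + Real.log M) := by
  have h1 := abs_mul_log_sub_mul_log_le (x := m) (x' := m') hm hm'
  have h2 := abs_mul_log_sub_mul_log_le (x := k) (x' := k') (le_trans hkm hm) (le_trans hkm' hm')
  have h3 := abs_mul_log_sub_mul_log_le (x := m - k) (x' := m' - k') (M := M) (by omega) (by omega)
  unfold entB
  rw [show (m' : ℝ) - k' = ((m' - k' : ℕ) : ℝ) by rw [Nat.cast_sub hkm'],
    show (m : ℝ) - k = ((m - k : ℕ) : ℝ) by rw [Nat.cast_sub hkm]]
  have hL : 0 ≤ 1 + Real.log M := by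
    rcases Nat.eq_zero_or_pos M with rfl | hM
    · simp
    · have : (1:ℝ) ≤ M := by exact_mod_cast hM
      linarith [Real.log_nonneg this]
  rw [abs_le] at h1 h2 h3 ⊢
  constructor <;> nlinarith [h1.1, h1.2, h2.1, h2.2, h3.1, h3.2, abs_nonneg ((m':ℝ) - m),
    abs_nonneg ((k':ℝ) - k), abs_nonneg (((m' - k' : ℕ) : ℝ) - ((m - k : ℕ) : ℝ)), hL]

end EntShift

end Literature.Computability.Complexity
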